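import Summits.BirchSwinnertonDyer.Rank1Residual.AdditivePotMult.TwistDescent
import HarnessLib

/-!
# The `Λ`-dual datum of the `χ_K`-eigen-Selmer group and the transport of dual data along [C] — kernel brick 3 (consumer direction) (cell `b2b-bsdres`, seat additive-p1, gen 8)

HONEST FRAMING (cell `b2b-bsdres`, run/shared/lean/b2b/bsd-rank1-residual/, verbatim in every
file): the goal of the cell is to DELETE the COMBINATION-SHAPED residual classes of the
Birch–Swinnerton-Dyer formula for ALL analytic-rank `≤ 1` elliptic curves over `ℚ` — "full BSD
formula for every rank `≤ 1` curve in class `C`" assembled STRICTLY from published theorems — so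
that the rank-`≤ 1` remainder becomes exactly the CONSTRUCTION-SHAPED classes, which are TYPED
(missing-input `Prop`s), NOT attempted. This is not "finishing BSD". The additive sub-cell (seats
additive-p1…p4) is a RESEARCH ROUTE on the construction-shaped classes X3/X4; sub-cell additive-p1
= the potentially MULTIPLICATIVE additive prime (X3♯(M) / X4(M)); no claim beyond the stated
classes; the labels of X3/X4 are UNCHANGED by this file; nothing is booked.

One hypothesis STRUCTURE (the exact analogue of the tree's `WeierstrassCurve.SelmerDualData` for
the eigen-subgroup; no predicate, no named fact), definitions = concrete maps, and theorems.
Context: design HOME/b2b-bsdres-additive-p1/KERNEL-C-P3.md. `TwistDescent.lean` (bricks 1–2)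
gives `Θ : Sel_{p^∞}(E/ℚ_∞) ≃+ Sel_{p^∞}(E♭/K·ℚ_∞)^{(χ_K)} = chiEigenSelmer`, equivariant for
`γ ∈ Gal(ℚ̄/K)`. This file:

* `conjH1_mem_chiEigenSelmer` — `chiEigenSelmer` is stable under every `γ_*`, `γ ∈ Γ_ℚ`;
* `ChiEigenSelmerDualData V K κ γ` — a `Λ`-module `X` with `X ≅ Hom(chiEigenSelmer, ℚ/ℤ)`,
  `T ↔ γ_* − 1`, constants through `ℤ_p → ℤ/p^k` — THE VOCABULARY in which the `e_χ`-component
  of Wuthrich 2014 Thm 16 / Kato 2004 Thm 17.4(3) over `ℚ(μ_{p^∞})` ("`char_Λ X(E♭)` divides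
  `(L_p(E♭))`" in `Λ = ℤ_p[Δ]⟦Γ⟧ = ⊕_i Λ(Γ)e_i`, Wuthrich §3 p. 390) is to be transcribed at
  `p = 3`, `K = ℚ(√−3)` (brick 4, a reading-fact for the literature seat / referee);
* `SelmerDualData.toChiEigen` — **every `Λ`-dual datum `D` of `Sel_{p^∞}(E/ℚ_∞)` (any model `W`
  of `E = E♭ ⊗ χ_K`, `γ ∈ Gal(ℚ̄/K)`, `p` odd) IS a `ChiEigenSelmerDualData` with the SAME
  `Λ`-module `D.X`**; so `Module.charIdeal`/`Module.IsTorsion` of the eigen-datum are `D.charIdeal` /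
  `D.IsTorsion` on the nose (`charIdeal_toChiEigen`, `isTorsion_toChiEigen_iff`). Consequently a
  divisibility `L₃⁻(E♭, ω, T) ∈ char X^{(ω)}` (brick 4) yields `∃ g ∈ D.charIdeal, …` for EVERY
  `D : W.SelmerDualData κ γ` — the shape of `ChiBranchLeadingTermOddAt W 3` (brick 5: the
  generator normalisation `γ ↦ γ g₀ ∈ Gal(ℚ̄/K)`, `g₀ ∈ Gal(ℚ̄/ℚ_∞)` acting trivially, and the
  `T = 0` constant term, are NOT in this file).

References: R. Greenberg, LNM 1716 (1999), §1 p. 60 (`X = Hom(Sel, ℚ_p/ℤ_p)` as a `Λ`-module)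
[GreenbergLNM1716]; C. Wuthrich, Doc. Math. 19 (2014), §3 p. 390, Thm. 16 [Wuthrich2014];
T. Dokchitser (2013), §4 [Dokchitser2013ParityNotes].
-/

noncomputable section

open scoped Classical

namespace Summit.BirchSwinnertonDyer.Rank1Residual.AdditivePotMult

open Literature.NumberTheory.EllipticCurves Literature.NumberTheory.GaloisRepresentations
  WeierstrassCurve

/-! ## §C The `Λ`-dual of the `χ_K`-eigen-Selmer group (brick 3, consumer direction) -/

section Dual

variable (V : WeierstrassCurve ℚ) (K : Type) [Field K] [NumberField K]
  {p : ℕ} [Fact p.Prime] (κ : ZpExtension ℚ p) [(galRange (K := ℚ) K).Normal]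
  (γ : Field.absoluteGaloisGroup ℚ)

/-- Conjugation by ANY `γ ∈ Γ_ℚ` preserves `chiEigenSelmer`: it preserves the Selmer group
(`map_conjH1_selmerGroupOver_le_holds`) and commutes with the action of every `g ∈ ker κ` up to an
element of `H = ker κ ⊓ galRange K` (both quotients `Γ_ℚ/ker κ`, `Γ_ℚ/galRange K` are abelian),
which acts trivially (`conjH1_of_mem`). [folklore] -/
theorem conjH1_mem_chiEigenSelmer {t : V.subgroupH1 p (κ.kerSubgroup ⊓ galRange (K := ℚ) K)}
    (ht : t ∈ chiEigenSelmer V K p κ) :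
    V.conjH1 p _ γ t ∈ chiEigenSelmer V K p κ := by
  refine ⟨V.map_conjH1_selmerGroupOver_le_holds p _ γ ⟨t, ht.1, rfl⟩, fun g ↦ ?_⟩
  -- `g γ = γ g h` with `h = g⁻¹ γ⁻¹ g γ ∈ H`... we use `γ⁻¹ g γ ∈ ker κ` and compare signs
  have hg' : γ⁻¹ * (g : Field.absoluteGaloisGroup ℚ) * γ ∈ κ.kerSubgroup :=
    κ.kerSubgroup_normal.conj_mem' _ g.2 γ  -- conj_mem' : n ∈ N → g⁻¹ * n * g ∈ N ?
  have h1 : V.conjH1 p _ (g : Field.absoluteGaloisGroup ℚ) (V.conjH1 p _ γ t) =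
      V.conjH1 p _ γ (V.conjH1 p _ (γ⁻¹ * (g : Field.absoluteGaloisGroup ℚ) * γ) t) := by
    rw [← AddMonoidHom.comp_apply, ← V.conjH1_mul_holds p, ← AddMonoidHom.comp_apply,
      ← V.conjH1_mul_holds p, ← mul_assoc, ← mul_assoc, mul_inv_cancel, one_mul]
  rw [h1, ht.2 ⟨_, hg'⟩, map_zsmul]
  -- signs agree: `γ⁻¹ g γ ∈ galRange K ↔ g ∈ galRange K` (normal subgroup)
  congr 1
  by_cases hg : (g : Field.absoluteGaloisGroup ℚ) ∈ galRange (K := ℚ) K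
  · rw [quadSign_of_mem K hg, quadSign_of_mem K]
    exact Subgroup.Normal.conj_mem' inferInstance _ hg γ
  · rw [quadSign_of_not_mem K hg, quadSign_of_not_mem K]
    intro h'
    apply hg
    have := Subgroup.Normal.conj_mem inferInstance _ h' γ
    simpa [mul_assoc] using this

/-- **The `Λ`-dual datum of the `χ_K`-eigen-Selmer group** `Sel_{p^∞}(E♭/K·ℚ_∞)^{(χ_K)}`: an
abstract `Λ = ℤ_p⟦T⟧`-module `X` with a group isomorphism onto the character group
`Hom(chiEigenSelmer, ℚ/ℤ)` under which `T` acts as `γ_* − 1` and constants `c ∈ ℤ_p` through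
`ℤ_p → ℤ/p^k` — the exact analogue of the tree's `WeierstrassCurve.SelmerDualData` (file
`IwasawaSelmer`) for the eigen-subgroup. At `p = 3`, `K = ℚ(√−3)`, this is the vocabulary in which
the `e₋`-component of Wuthrich 2014 Thm 16 / Kato 17.4(3) over `ℚ(μ_{3^∞})` is to be transcribed
(brick 4 of HOME/b2b-bsdres-additive-p1/KERNEL-C-P3.md). Greenberg, LNM 1716 (1999), §1 (p. 60),
§3 p. 390 of Wuthrich 2014 (eigenspaces `M = ⊕ M_i`). [cite: GreenbergLNM1716, §1 p. 60] -/
structure ChiEigenSelmerDualData where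
  /-- The underlying type of the Iwasawa module `X^{(χ)}`. -/
  X : Type
  /-- `X` is an abelian group. -/
  [addCommGroup : AddCommGroup X]
  /-- `X` is a `Λ = ℤ_p⟦T⟧`-module. -/
  [module : Module (IwasawaAlgebra p) X]
  /-- The identification of `X` with the character group `Hom(Sel^{(χ)}, ℚ/ℤ)`. -/
  toDual : X →+ (chiEigenSelmer V K p κ →+ AddCircle (1 : ℚ))
  /-- `toDual` is a group isomorphism. -/
  bijective : Function.Bijective toDual
  /-- `T` acts as `γ - 1`. -/
  toDual_T_smul : ∀ (x : X) (s : chiEigenSelmer V K p κ),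
    toDual ((PowerSeries.X : IwasawaAlgebra p) • x) s =
      toDual x ⟨V.conjH1 p _ γ s, conjH1_mem_chiEigenSelmer V K κ γ s.2⟩ - toDual x s
  /-- Constants `c ∈ ℤ_p` act on `p^k`-torsion classes through `ℤ_p → ℤ/p^k`. -/
  toDual_C_smul : ∀ (c : ℤ_[p]) (x : X) (s : chiEigenSelmer V K p κ) (k : ℕ), (p ^ k) • s = 0 →
    toDual (PowerSeries.C c • x) s = (PadicInt.toZModPow k c).val • toDual x s

attribute [instance] ChiEigenSelmerDualData.addCommGroup ChiEigenSelmerDualData.module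

end Dual

/-! ## §D Transport of a dual datum of `Sel(E/ℚ_∞)` to a dual datum of `Sel(E♭/K·ℚ_∞)^{(χ)}` -/

section Transport

variable (V : WeierstrassCurve ℚ) (K : Type) [Field K] [NumberField K]
  (h2 : Module.finrank ℚ K = 2) {θ : K} {c : ℚ} (hθ : θ ∉ Set.range (algebraMap ℚ K))
  (hc : θ ^ 2 = algebraMap ℚ K c) (p : ℕ) [Fact p.Prime] (κ : ZpExtension ℚ p)
  [(galRange (K := ℚ) K).Normal] [(V.quadraticTwist c).IsElliptic]
  {W : WeierstrassCurve ℚ} {C : VariableChange ℚ} (hCW : C • V.quadraticTwist c = W)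
  (hp2 : p ≠ 2) {γ : Field.absoluteGaloisGroup ℚ} (hγ : γ ∈ galRange (K := ℚ) K)

/-- Precomposition with the inverse transport, on character groups. [folklore] -/
def dualTransport (hp2 : p ≠ 2) :
    (W.selmerInfty κ →+ AddCircle (1 : ℚ)) →+ (chiEigenSelmer V K p κ →+ AddCircle (1 : ℚ)) :=
  AddMonoidHom.compHom'
    (twistDescentEquiv V K h2 hθ hc p κ hCW hp2).symm.toAddMonoidHom

/-- Values of `dualTransport`. [folklore] -/
theorem dualTransport_apply (hp2 : p ≠ 2) (x : W.selmerInfty κ →+ AddCircle (1 : ℚ))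
    (s : chiEigenSelmer V K p κ) :
    dualTransport V K h2 hθ hc p κ hCW hp2 x s =
      x ((twistDescentEquiv V K h2 hθ hc p κ hCW hp2).symm s) :=
  rfl

/-- `dualTransport` is bijective (precomposition with an isomorphism). [folklore] -/
theorem dualTransport_bijective (hp2 : p ≠ 2) :
    Function.Bijective (dualTransport V K h2 hθ hc p κ hCW hp2) := by
  set Θ := twistDescentEquiv V K h2 hθ hc p κ hCW hp2
  refine ⟨fun x y hxy ↦ ?_, fun z ↦ ⟨z.comp Θ.toAddMonoidHom, ?_⟩⟩
  · ext s
    have h := DFunLike.congr_fun hxy (Θ s)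
    rw [dualTransport_apply, dualTransport_apply, AddEquiv.symm_apply_apply] at h
    exact h
  · ext s
    rw [dualTransport_apply, AddMonoidHom.comp_apply]
    change z (Θ (Θ.symm s)) = z s
    rw [AddEquiv.apply_symm_apply]

include hγ in
/-- For `γ ∈ Gal(ℚ̄/K)` the transport commutes with `γ_*` (as elements of the Selmer groups).
[folklore] -/
theorem twistDescentEquiv_symm_conj (hp2 : p ≠ 2) (s : chiEigenSelmer V K p κ) :
    ((twistDescentEquiv V K h2 hθ hc p κ hCW hp2).symm
        ⟨V.conjH1 p _ γ s, conjH1_mem_chiEigenSelmer V K κ γ s.2⟩ : W.subgroupH1 p κ.kerSubgroup) =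
      W.conjH1 p κ.kerSubgroup γ
        ((twistDescentEquiv V K h2 hθ hc p κ hCW hp2).symm s : W.selmerInfty κ) := by
  set Θ := twistDescentEquiv V K h2 hθ hc p κ hCW hp2 with hΘ
  -- the class `γ_* (Θ⁻¹ s)` is a Selmer class; `Θ` of it is `γ_* s` by the bookkeeping lemma
  set s' : W.selmerInfty κ := Θ.symm s with hs'
  let t : W.selmerInfty κ := ⟨W.conjH1 p κ.kerSubgroup γ (s' : W.subgroupH1 p κ.kerSubgroup),
    W.map_conjH1_selmerGroupOver_le_holds p κ.kerSubgroup γ ⟨s', s'.2, rfl⟩⟩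
  have ht : Θ t = ⟨V.conjH1 p _ γ s, conjH1_mem_chiEigenSelmer V K κ γ s.2⟩ := by
    apply Subtype.ext
    rw [hΘ, coe_twistDescentEquiv_conjH1 V K h2 hθ hc p κ hCW hp2 γ s' t rfl, quadSign_of_mem K hγ,
      one_smul, ← hΘ, hs', AddEquiv.apply_symm_apply]
  rw [← ht, AddEquiv.symm_apply_apply]

include hγ in
/-- **Transport of dual data (brick 3, consumer direction).** A `Λ`-dual datum `D` of
`Sel_{p^∞}(E/ℚ_∞)` (`W.SelmerDualData κ γ` with `γ ∈ Gal(ℚ̄/K)`) IS a `Λ`-dual datum of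
`Sel_{p^∞}(E♭/K·ℚ_∞)^{(χ_K)}` with the SAME underlying `Λ`-module `D.X`, through
`twistDescentEquiv` (equivariant for `γ ∈ Gal(ℚ̄/K)`). Hence `charIdeal` and `IsTorsion` coincide
literally (`charIdeal_toChiEigen`, `isTorsion_toChiEigen_iff`): any divisibility proved for the
`χ_K`-eigenspace dual (brick 4) is a divisibility for `X(E/ℚ_∞)`. [folklore] -/
def SelmerDualData.toChiEigen (hp2 : p ≠ 2) (D : W.SelmerDualData κ γ) :
    ChiEigenSelmerDualData V K κ γ where
  X := D.X
  toDual := (dualTransport V K h2 hθ hc p κ hCW hp2).comp D.toDual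
  bijective := (dualTransport_bijective V K h2 hθ hc p κ hCW hp2).comp D.bijective
  toDual_T_smul := fun x s ↦ by
    rw [AddMonoidHom.comp_apply, AddMonoidHom.comp_apply, dualTransport_apply,
      dualTransport_apply, dualTransport_apply, D.toDual_T_smul]
    congr 2
    apply Subtype.ext
    exact (twistDescentEquiv_symm_conj V K h2 hθ hc p κ hCW hγ hp2 s).symm
  toDual_C_smul := fun c' x s k hk ↦ by
    rw [AddMonoidHom.comp_apply, AddMonoidHom.comp_apply, dualTransport_apply, dualTransport_apply]
    exact D.toDual_C_smul c' x _ k (by rw [← map_nsmul, hk, map_zero])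

/-- The transported datum has the same underlying module. [folklore] -/
theorem SelmerDualData.toChiEigen_X (hp2 : p ≠ 2) (D : W.SelmerDualData κ γ) :
    (SelmerDualData.toChiEigen V K h2 hθ hc p κ hCW hγ hp2 D).X = D.X :=
  rfl

/-- **Same characteristic ideal** (`Module.charIdeal` of the transported datum is `D.charIdeal`).
[folklore] -/
theorem SelmerDualData.charIdeal_toChiEigen (hp2 : p ≠ 2) (D : W.SelmerDualData κ γ) :
    Literature.NumberTheory.EllipticCurves.Module.charIdeal (IwasawaAlgebra p)
        (SelmerDualData.toChiEigen V K h2 hθ hc p κ hCW hγ hp2 D).X = D.charIdeal :=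
  rfl

/-- **Same torsion-ness.** [folklore] -/
theorem SelmerDualData.isTorsion_toChiEigen_iff (hp2 : p ≠ 2) (D : W.SelmerDualData κ γ) :
    Module.IsTorsion (IwasawaAlgebra p) (SelmerDualData.toChiEigen V K h2 hθ hc p κ hCW hγ hp2 D).X ↔
      D.IsTorsion :=
  Iff.rfl

end Transport

end Summit.BirchSwinnertonDyer.Rank1Residual.AdditivePotMult

end
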